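import Summits.QuantumFields.BalabanUV.T4Continuum.Support.NE7FlatSliceSourceDuality
import Summits.QuantumFields.BalabanUV.T4Continuum.Support.NE7ApeCurvedRepRoadBCombEnd
import Summits.QuantumFields.BalabanUV.T4Continuum.Support.AveragingDeficitPushForwardLinear
import HarnessLib

/-!
# NE7CombSliceSourceDuality — THE ONE REMAINING LETTER OF THE END OF RECORD IN SOURCE FORM, AT A CURVED BACKGROUND: lineage #2's ℓ¹–ℓ^∞ duality socket (137) re-typed at a
# unitary background `W` of the multi-level class and on the block-COMB slice — the FUNCTIONAL letter `hGcomb` of F145 (Hessian functional `g·ℓ¹`-bounded on the W-tangent slice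
# ⟹ curl bound) follows from the SOURCE letter a Green's-function estimate delivers («`hess_W X · = ⟨H, ·⟩` on the W-tangent slice for a skew periodic bond source `H` with
# `‖H‖_∞ ≤ g` ⟹ `‖curl_W X‖ ≤ K·g + K_X·R`»), with `K_G = card n · K` — step (1) of memo §6's docking roadmap (file 78 of the curved (APE))

Cell `pub-balaban`, rung (B)+1 sub-cell t4, lineage `b2b-balaban-t4-ne7-p1` (CRUX PROVER NE7 #1 = OWNER of row NE7), generation 81; memo `t4/b2b-balaban-t4-ne7-p1-g81/COMB-SLICE.md` §6–§7.
File F148, over lineage #2's (137) `NE7FlatSliceSourceDuality` (`exists_skewSource_of_l1DualBound` — the BACKGROUND-GENERIC Hahn–Banach ∕ Riesz engine on any real subspace of skew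
periodic fields; `srcPair`, `abs_srcPair_le`), row NE3's `NE3TangentCovariantTower.dirIter_add` ∕ `step_small`, `AveragingDeficitPushForwardLinear.pushDir_smul`,
`NE3EnergyHessBilin.hessBilin` BY NAME.
WHY.  Memo §6 located the one letter of F145 in print AS TYPE: [Balaban1985BackgroundPropagators] Thm 3.3 p. 399 — a SOURCE-form statement (`|∇_U G(U) J| ≤ B₀·L^jη·sup|J|`:
the solution of `Δ_a(U) X = J` has covariant gradient bounded by the sup of the source).  F145 consumes the letter in FUNCTIONAL form (the producer F44∕F135 bounds `Y ↦ hess_W X Y`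
only in the `ℓ¹`-dual norm).  At `U = 1` lineage #2's (137) proved the two forms equivalent up to `card n`; its engine is background-generic, but its adapters are typed at the
flat background (`dirIter L j 1`, `hess 1`).  THIS file re-types the adapters at a unitary `W` of the class and on the comb slice: the only new input is that the W-TANGENT skew
periodic fields form a REAL SUBSPACE — additivity is row NE3's `dirIter_add`, real homogeneity is §1 (`cpush_smul`, `dirIter_smul` through the tower, from `pushDir_smul`).
WHAT ([folklore]; 0 def, 0 sorry).  §1 `cpush_smul`, **`dirIter_smul`** (`dirIter L (j+1) W (c • A) = c • dirIter L (j+1) W A` in the multi-level small-field class); §2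
**`combSliceSolver_of_sourceSolver`** — F145's `hGcomb` with `(K_G, K_X) = (card n · K, K_X)` ⟸ the SOURCE letter on the comb slice with `(K, K_X)`; §3 `sourceSolver_of_combSliceSolver`
(converse, same constants); §4 **`smallField_of_tanCritical_roadB_comb_source`** — the END of record (F145) with its one letter in SOURCE form (conclusion radius: `K_G ↦ card n · K`).
HONEST FRAMING (page 1): duality bookkeeping at one configuration; the source letter is DISPLAYED, NOT proved (it is B9 Thm 3.3 TYPE on OUR operators — the dictionary of memo §6 is
not built); nothing of Bałaban's asserted; (APE) on curved data NOT proved; NOT ONE-STEP, NOT NE7; spine 0∕9; finite T⁴ rung (B)+1 — NOT infinite volume, NOT mass gap, NOT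
`BetaPertH`, NOT Clay.  Continuum YM on T⁴ ⇐ BetaPertH ∧ nine spine estimates (0/9 proved); BetaPertH ⇐ (D1) ∧ (D4) ∧ CAP+tail; G-an2-4 gates asym, D1 and NE2/3/4.
-/

set_option autoImplicit false

open scoped BigOperators Matrix Matrix.Norms.L2Operator
open NormedSpace Finset

namespace Summit.QuantumFields.BalabanUV.T4Continuum.NE7CombSliceSourceDuality

open Literature.MathematicalPhysics.QuantumFieldTheory.Balaban1983to89
open B7Prop1Explicit B7Prop2Explicit MatrixLog UnitaryModel MatrixNorms
open T4AveragingDeficitWall (Ad IsUnitaryCfg IsSkewDir SmallField curlAt dirL1 flux covGrad)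
open T4AveragingDeficitWallBoundary (IsPeriodicCfg periodBox)
open AveragingDeficitPeriodicCounting (IsPeriodicDir)
open AveragingDeficitTwoLevelPrep (twoLevelSmall)
open AveragingDeficitChartCalculus (cavg)
open AveragingDeficitMultiLevelPrep (cpush cavgIter LevelSmall)
open AveragingDeficitPushForwardLinear (pushDir_smul)
open MinimalActionLevels (perWin)
open BlockAverageVaryHolo (nbRad)
open NE3HessForm (hess dAction)
open NE3TangentCovariantStructure (norm_Wcx_sub_one_le_32)
open NE3TangentCovariantTower (dirIter step_small dirIter_add)
open NE3EnergyHessBilin (hessBilin hessBilin_apply)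
open NE3CovariantWeitzenbock (covDiv)
open NE3RightInverseSupLetters (frameC supC corrC)
open NE3QbarIterCovLiftPrep (cruxC)
open NE3RightInverseSolveLetters (thetaLoc)
open NE3HatInvCurlLetters (curl1C)
open BlockAverageVaryDisc (rho0)
open NE3LinearisedAverageSup (curvSum)
open SkeletonLattice (cmod)
open NE7FlatSliceSourceDuality (srcPair abs_srcPair_le exists_skewSource_of_l1DualBound)
open NE7ApeCurvedRepRoadBCombEnd (smallField_of_tanCritical_roadB_comb)

noncomputable section

variable {d : ℕ} {n : Type*} [Fintype n] [DecidableEq n]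

/-! ## §1 Real homogeneity of the linearised average through the tower -/

/-- `cpush` is real-homogeneous (in the ball of the small-field class). [folklore] -/
theorem cpush_smul [Nonempty n] {L : ℕ} (hL : 1 ≤ L) {W : Site d → Fin d → (Matrix n n ℂ)ˣ} (hWu : IsUnitaryCfg W)
    {a : ℝ} (ha : 0 ≤ a) (hsmall : 512 * (d + 1) * (d + 4) * (L : ℝ) ^ 2 * a ≤ 1) (hWa : SmallField W a)
    (c : ℝ) (A : Site d → Fin d → (Matrix n n ℂ)) :
    cpush L W (c • A) = c • cpush L W A := by
  funext z κ
  exact pushDir_smul L W c A ((L : ℤ) • z) κ (fun r => norm_Wcx_sub_one_le_32 hL hWu ha hsmall hWa ((L : ℤ) • z) κ r)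

/-- **REAL HOMOGENEITY THROUGH THE TOWER**: in the multi-level small-field class, `dirIter L (j+1) W (c • A) = c • dirIter L (j+1) W A`. [folklore] -/
theorem dirIter_smul [Nonempty n] {L : ℕ} (hL : 1 ≤ L) (j : ℕ) :
    ∀ {W : Site d → Fin d → (Matrix n n ℂ)ˣ} {x : ℝ}, IsUnitaryCfg W → 0 ≤ x → LevelSmall d L j x → SmallField W x →
    ∀ (c : ℝ) (A : Site d → Fin d → (Matrix n n ℂ)), dirIter L (j + 1) W (c • A) = c • dirIter L (j + 1) W A := by
  induction j with
  | zero =>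
      intro W x hWu hx hs hWx c A
      obtain ⟨h512, -, -, -⟩ := step_small hL hWu hx hs hWx
      exact cpush_smul hL hWu hx h512 hWx c A
  | succ j ih =>
      intro W x hWu hx hs hWx c A
      obtain ⟨h512, hW₁u, hr0, hW₁x⟩ := step_small hL hWu hx hs.1 hWx
      show dirIter L (j + 1) (cavg L W) (cpush L W (c • A)) = c • dirIter L (j + 1) (cavg L W) (cpush L W A)
      rw [cpush_smul hL hWu hx h512 hWx c A]
      exact ih hW₁u hr0 hs.2 hW₁x c _

/-! ## §2 The functional letter on the comb slice from the source letter -/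

/-- **F145's LETTER `hGcomb` FROM ITS SOURCE FORM** (`L ≥ 1`, `N`, `j`, `P = N·L^{j+1} ≥ 1`, `M = L^{j+1}`; `W` unitary of the class).  HYPOTHESIS `hSrc` (the SOURCE letter on the
comb slice — B9 Thm 3.3 TYPE, NOT proved here): for every skew `X` vanishing on the in-block comb bonds, `P`-periodic and W-tangent, every sup bound `R` of `X`, every skew `P`-periodic
bond source `H` with `‖H‖_∞ ≤ g` such that `hess W X Y (perWin d P) = ⟨H, Y⟩_{periodBox P}` for all W-tangent skew `P`-periodic `Y`: `‖curlAt W X z μ ν‖ ≤ K·g + K_X·R`.  CONCLUSION: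
F145's functional letter with `(K_G, K_X) = (card n · K, K_X)`. [folklore] -/
theorem combSliceSolver_of_sourceSolver [Nonempty n] {L N : ℕ} [NeZero N] (hL : 1 ≤ L) (j : ℕ)
    {W : Site d → Fin d → (Matrix n n ℂ)ˣ} {x : ℝ} (hWu : IsUnitaryCfg W) (hx : 0 ≤ x) (hs : LevelSmall d L j x) (hWx : SmallField W x)
    {K KX : ℝ}
    (hSrc : ∀ X : Site d → Fin d → (Matrix n n ℂ), IsSkewDir X →
      (∀ (z : Site d) (μ : Fin d), (∀ κ, κ < μ → cmod (L ^ (j + 1)) z κ = 0) → cmod (L ^ (j + 1)) z μ + 1 < ((L ^ (j + 1) : ℕ) : ℤ) → X z μ = 0) →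
      IsPeriodicDir X ((N * L ^ (j + 1) : ℕ) : ℤ) → dirIter L (j + 1) W X = 0 → ∀ R : ℝ, (∀ y κ', ‖X y κ'‖ ≤ R) →
      ∀ H : Site d → Fin d → (Matrix n n ℂ), IsSkewDir H → IsPeriodicDir H ((N * L ^ (j + 1) : ℕ) : ℤ) → ∀ g : ℝ, 0 ≤ g → (∀ (y : Site d) (κ : Fin d), ‖H y κ‖ ≤ g) →
      (∀ Y : Site d → Fin d → (Matrix n n ℂ), IsSkewDir Y → IsPeriodicDir Y ((N * L ^ (j + 1) : ℕ) : ℤ) → dirIter L (j + 1) W Y = 0 →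
        hess W X Y (perWin d (N * L ^ (j + 1))) = srcPair H Y (periodBox (d := d) (N * L ^ (j + 1)))) →
      ∀ z μ' ν', μ' ≠ ν' → ‖curlAt W X z μ' ν'‖ ≤ K * g + KX * R) :
    ∀ X : Site d → Fin d → (Matrix n n ℂ), IsSkewDir X →
      (∀ (z : Site d) (μ : Fin d), (∀ κ, κ < μ → cmod (L ^ (j + 1)) z κ = 0) → cmod (L ^ (j + 1)) z μ + 1 < ((L ^ (j + 1) : ℕ) : ℤ) → X z μ = 0) →
      IsPeriodicDir X ((N * L ^ (j + 1) : ℕ) : ℤ) → dirIter L (j + 1) W X = 0 → ∀ R : ℝ, (∀ y κ', ‖X y κ'‖ ≤ R) → ∀ g : ℝ, 0 ≤ g →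
      (∀ Y : Site d → Fin d → (Matrix n n ℂ), IsSkewDir Y → IsPeriodicDir Y ((N * L ^ (j + 1) : ℕ) : ℤ) → dirIter L (j + 1) W Y = 0 →
        |hess W X Y (perWin d (N * L ^ (j + 1)))| ≤ g * dirL1 Y (periodBox (d := d) (N * L ^ (j + 1)))) →
      ∀ z μ' ν', μ' ≠ ν' → ‖curlAt W X z μ' ν'‖ ≤ (Fintype.card n * K) * g + KX * R := by
  intro X hXs hXc hXP hXT R hR g hg hfun z μ' ν' hne
  haveI : NeZero (N * L ^ (j + 1)) := ⟨Nat.mul_ne_zero (NeZero.ne N) (pow_ne_zero _ (by omega))⟩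
  -- the W-tangent skew periodic fields as a real subspace
  let S : Submodule ℝ (Site d → Fin d → (Matrix n n ℂ)) :=
    { carrier := {Y | IsSkewDir Y ∧ IsPeriodicDir Y ((N * L ^ (j + 1) : ℕ) : ℤ) ∧ dirIter L (j + 1) W Y = 0}
      add_mem' := by
        rintro Y Z ⟨hYs, hYP, hYT⟩ ⟨hZs, hZP, hZT⟩
        refine ⟨fun y κ => (skewAdjoint (Matrix n n ℂ)).add_mem (hYs y κ) (hZs y κ), fun y κ μ => ?_, ?_⟩
        · show Y (y + ((N * L ^ (j + 1) : ℕ) : ℤ) • e κ) μ + Z (y + ((N * L ^ (j + 1) : ℕ) : ℤ) • e κ) μ = Y y μ + Z y μ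
          rw [hYP, hZP]
        · have h := dirIter_add hL j hWu hx hs hWx Y Z
          have hYZ : (fun y μ => Y y μ + Z y μ) = Y + Z := rfl
          rw [hYZ] at h
          rw [h]
          funext z' κ'
          rw [hYT, hZT]
          simp
      zero_mem' := by
        refine ⟨fun y κ => (skewAdjoint (Matrix n n ℂ)).zero_mem, fun y κ μ => rfl, ?_⟩
        have h := dirIter_smul hL j hWu hx hs hWx 0 0
        rwa [zero_smul, zero_smul] at h
      smul_mem' := by
        rintro c Y ⟨hYs, hYP, hYT⟩
        refine ⟨fun y κ => skewAdjoint.smul_mem c (hYs y κ), fun y κ μ => ?_, ?_⟩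
        · show c • Y (y + ((N * L ^ (j + 1) : ℕ) : ℤ) • e κ) μ = c • Y y μ
          rw [hYP]
        · rw [dirIter_smul hL j hWu hx hs hWx c Y, hYT, smul_zero] }
  obtain ⟨H, hHs, hHP, hHb, hrep⟩ := exists_skewSource_of_l1DualBound (N * L ^ (j + 1)) S (fun Y hY => hY.1)
    (fun Y hY => hY.2.1) (hessBilin W (perWin d (N * L ^ (j + 1))) X) hg
    (fun Y hY => by rw [hessBilin_apply]; exact hfun Y hY.1 hY.2.1 hY.2.2)
  have h := hSrc X hXs hXc hXP hXT R hR H hHs hHP (Fintype.card n * g) (by positivity) hHb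
    (fun Y hYs hYP hYT => by rw [← hessBilin_apply]; exact hrep Y ⟨hYs, hYP, hYT⟩) z μ' ν' hne
  calc ‖curlAt W X z μ' ν'‖ ≤ K * (Fintype.card n * g) + KX * R := h
    _ = Fintype.card n * K * g + KX * R := by ring

/-! ## §3 The converse -/

/-- **THE CONVERSE**: F145's functional letter with `(K, K_X)` implies the source letter with the same constants (`|⟨H, Y⟩| ≤ ‖H‖_∞‖Y‖₁`). [folklore] -/
theorem sourceSolver_of_combSliceSolver {L N : ℕ} (j : ℕ) {W : Site d → Fin d → (Matrix n n ℂ)ˣ} {K KX : ℝ}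
    (hG : ∀ X : Site d → Fin d → (Matrix n n ℂ), IsSkewDir X →
      (∀ (z : Site d) (μ : Fin d), (∀ κ, κ < μ → cmod (L ^ (j + 1)) z κ = 0) → cmod (L ^ (j + 1)) z μ + 1 < ((L ^ (j + 1) : ℕ) : ℤ) → X z μ = 0) →
      IsPeriodicDir X ((N * L ^ (j + 1) : ℕ) : ℤ) → dirIter L (j + 1) W X = 0 → ∀ R : ℝ, (∀ y κ', ‖X y κ'‖ ≤ R) → ∀ g : ℝ, 0 ≤ g →
      (∀ Y : Site d → Fin d → (Matrix n n ℂ), IsSkewDir Y → IsPeriodicDir Y ((N * L ^ (j + 1) : ℕ) : ℤ) → dirIter L (j + 1) W Y = 0 →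
        |hess W X Y (perWin d (N * L ^ (j + 1)))| ≤ g * dirL1 Y (periodBox (d := d) (N * L ^ (j + 1)))) →
      ∀ z μ' ν', μ' ≠ ν' → ‖curlAt W X z μ' ν'‖ ≤ K * g + KX * R) :
    ∀ X : Site d → Fin d → (Matrix n n ℂ), IsSkewDir X →
      (∀ (z : Site d) (μ : Fin d), (∀ κ, κ < μ → cmod (L ^ (j + 1)) z κ = 0) → cmod (L ^ (j + 1)) z μ + 1 < ((L ^ (j + 1) : ℕ) : ℤ) → X z μ = 0) →
      IsPeriodicDir X ((N * L ^ (j + 1) : ℕ) : ℤ) → dirIter L (j + 1) W X = 0 → ∀ R : ℝ, (∀ y κ', ‖X y κ'‖ ≤ R) →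
      ∀ H : Site d → Fin d → (Matrix n n ℂ), IsSkewDir H → IsPeriodicDir H ((N * L ^ (j + 1) : ℕ) : ℤ) → ∀ g : ℝ, 0 ≤ g → (∀ (y : Site d) (κ : Fin d), ‖H y κ‖ ≤ g) →
      (∀ Y : Site d → Fin d → (Matrix n n ℂ), IsSkewDir Y → IsPeriodicDir Y ((N * L ^ (j + 1) : ℕ) : ℤ) → dirIter L (j + 1) W Y = 0 →
        hess W X Y (perWin d (N * L ^ (j + 1))) = srcPair H Y (periodBox (d := d) (N * L ^ (j + 1)))) →
      ∀ z μ' ν', μ' ≠ ν' → ‖curlAt W X z μ' ν'‖ ≤ K * g + KX * R := by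
  intro X hXs hXc hXP hXT R hR H _ _ g hg hHb hrep z μ' ν' hne
  exact hG X hXs hXc hXP hXT R hR g hg (fun Y hYs hYP hYT => by rw [hrep Y hYs hYP hYT]; exact abs_srcPair_le hHb) z μ' ν' hne

/-! ## §4 The END of record with its one letter in source form -/

set_option maxHeartbeats 400000 in
/-- **THE CURVED (APE) WITH A DATUM FROM THE CLASS DATA + ONE COMB-SLICE LETTER IN SOURCE FORM**: F145 `smallField_of_tanCritical_roadB_comb` with `hGcomb` supplied by §2 from the
SOURCE letter `hSrc`; the radius reads `K_G = card n · K`. [folklore] -/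
theorem smallField_of_tanCritical_roadB_comb_source [Nonempty n] (hd : 2 ≤ d) {L N : ℕ} [NeZero N] (hL : 2 ≤ L) (j : ℕ)
    -- the background
    {W : Site d → Fin d → (Matrix n n ℂ)ˣ} {x : ℝ} (hWu : IsUnitaryCfg W) (hWP : IsPeriodicCfg W ((N * L ^ (j + 1) : ℕ) : ℤ))
    (hx : 0 ≤ x) (hs : LevelSmall d L j x) (hWx : SmallField W x)
    -- the sup radius of the representative and the regime at `x′ = x + 4(e^{α₀} − 1)`
    {α₀ : ℝ} (hα0 : 0 ≤ α₀) (hs' : LevelSmall d L j (x + 4 * (Real.exp α₀ - 1)))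
    (hθ : cruxC d L * (((L : ℝ) ^ (j + 1)) ^ 2 * (x + 4 * (Real.exp α₀ - 1))) < 1)
    (hθl : thetaLoc d L * (((L : ℝ) ^ (j + 1)) ^ 2 * (x + 4 * (Real.exp α₀ - 1))) < 1)
    (hε : ((L : ℝ) ^ (j + 1)) ^ 2 * (x + 4 * (Real.exp α₀ - 1)) ≤ 1)
    -- the field: of the class, tangent-critical, over `W`'s datum
    {U : Site d → Fin d → (Matrix n n ℂ)ˣ} (hUu : IsUnitaryCfg U) (hUP : IsPeriodicCfg U ((N * L ^ (j + 1) : ℕ) : ℤ))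
    {xU : ℝ} (hxU : 0 ≤ xU) (hsU : LevelSmall d L j xU) (hUxU : SmallField U xU)
    (hcritU : ∀ Y : Site d → Fin d → Matrix n n ℂ, IsSkewDir Y → IsPeriodicDir Y ((N * L ^ (j + 1) : ℕ) : ℤ) →
      dirIter L (j + 1) U Y = 0 → dAction U Y (perWin d (N * L ^ (j + 1))) = 0)
    (hTopUW : cavgIter L (j + 1) U = cavgIter L (j + 1) W)
    -- row NE3's class data of `W` and E′'s initial gauge ∕ regime (as in `exists_landauRep_W`), the constant `c_RE` named; road (B)'s two extra regime lines
    -- the FLUX-GRADIENT radii of `W` and `U` (row NE3's `RegularSup` datum; (1.8)∕(1.9) TYPE via `NE3FluxGradientDictionary` ∕ `MinimalActionClassSix`)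
    {gW gU : ℝ} (hgW : ∀ (z : Site d) (μ : Fin d) (π : T4AveragingDeficitWall.Plane d), ‖T4AveragingDeficitWall.covGrad W (T4AveragingDeficitWall.flux W) z μ π‖ ≤ gW)
    (hgU : ∀ (z : Site d) (μ : Fin d) (π : T4AveragingDeficitWall.Plane d), ‖T4AveragingDeficitWall.covGrad U (T4AveragingDeficitWall.flux U) z μ π‖ ≤ gU)
    (hbx : 23040 * (d : ℝ) ^ 4 * (frameC d L + d) ^ 2 * ((L : ℝ) ^ (j + 1)) ^ 2 * x ≤ 1)
    (hcx : 11520 * (d : ℝ) ^ 4 * (frameC d L + d) ^ 3 * ((L : ℝ) ^ (j + 1)) ^ 3 * (2 * gW) ≤ 1)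
    (hbx' : 256 * (d : ℝ) ^ 2 * ((L : ℝ) ^ (j + 1)) ^ 2 * x ≤ 1) (hcx' : 16 * (d : ℝ) * ((L : ℝ) ^ (j + 1)) ^ 3 * (2 * gW) ≤ 1)
    {r₀ b₀ : ℝ} (hr₀ : ∀ (y : Site d) (μ : Fin d), ‖(((W y μ)⁻¹ * U y μ : (Matrix n n ℂ)ˣ) : (Matrix n n ℂ)) - 1‖ ≤ r₀)
    (hb₀ : ∀ x : Site d, ‖covDiv W (fun y μ => mlog (((W y μ)⁻¹ * U y μ : (Matrix n n ℂ)ˣ) : (Matrix n n ℂ))) x‖ ≤ b₀)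
    {cRE : ℝ} (hcRE : cRE = 1 + 2 * (Fintype.card n : ℝ) * (64 * (d : ℝ) ^ 2 * N) ^ d + 27 * (Fintype.card n : ℝ) ^ 3 * (512 : ℝ) ^ d * (N : ℝ) ^ d)
    (hreg₁ : (36 * (d : ℝ) * (frameC d L + d) ^ 2) * ((L : ℝ) ^ (j + 1)) ^ 2 * (cRE * b₀) ≤ 1 / 10)
    (hreg₂ : (36 * (d : ℝ) * (frameC d L + d)) * (L : ℝ) ^ (j + 1) * (cRE * b₀) ≤ 1 / 25)
    (hreg₃ : r₀ + 5 / 2 * ((36 * (d : ℝ) * (frameC d L + d)) * (L : ℝ) ^ (j + 1) * (cRE * b₀)) ≤ 1 / 20)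
    (hline : cRE * (4 * ((36 * (d : ℝ) * (frameC d L + d) ^ 2) * ((L : ℝ) ^ (j + 1)) ^ 2) * (b₀ + 4 * (cRE * b₀))
        + 25 * d * (r₀ + 5 / 2 * ((36 * (d : ℝ) * (frameC d L + d)) * (L : ℝ) ^ (j + 1) * (cRE * b₀))) * ((36 * (d : ℝ) * (frameC d L + d)) * (L : ℝ) ^ (j + 1))
        + 14 * d * ((36 * (d : ℝ) * (frameC d L + d)) * (L : ℝ) ^ (j + 1)) ^ 2 * (cRE * b₀)) ≤ 1 / 2)
    -- E′'s radii named: `α_E`, `θ_u`; the tent extension's `δ = corrC∕M·2θ_u`; road (B)'s regime `α_E ≤ 1∕40`, `θ_u ≤ 1∕160`, `δ ≤ 1∕40`, `α₀ ≥ α_E + δ + 4(2θ_u+δ)(α_E+δ)`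
    {αE θu : ℝ} (hαE : αE = 2 * (r₀ + 5 / 2 * ((36 * (d : ℝ) * (frameC d L + d)) * (L : ℝ) ^ (j + 1) * (cRE * b₀))))
    (hθu : θu = 4 * ((36 * (d : ℝ) * (frameC d L + d) ^ 2) * ((L : ℝ) ^ (j + 1)) ^ 2 * (cRE * b₀)))
    (hαE40 : αE ≤ 1 / 40) (hθu160 : θu ≤ 1 / 160)
    {δ : ℝ} (hδ : δ = corrC d / (L : ℝ) ^ (j + 1) * (2 * θu)) (hδ40 : δ ≤ 1 / 40) (hα₀ : αE + δ + 4 * (2 * θu + δ) * (αE + δ) ≤ α₀)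
    -- the remaining analytic letters at `W`: (L1)′ and α₁ for the SAME-TOP structured fields of radius `α₀`, (L2), (L3) discharged
    -- (L1)′ DISCHARGED (F111): the quadratic-remainder regime, the slice `S` containing the `W`-tangent skew periodic fields, and the names `c_N = 4m`, `ν = 24·#Plane·m`
    (hs1 : LevelSmall d L (j + 1) x) (hA : curvSum d L (j + 1) x ≤ 2 / 3 * L) (hσ0 : 4 * (3 + 12 * (d : ℝ)) ^ 2 * (L : ℝ) ^ (j + 1) * α₀ ≤ rho0 d L ^ 2)
    {cN aN K KX ν : ℝ} (haN : aN = (supC d L / ((L : ℝ) ^ (j + 1) * (1 - cruxC d L * (((L : ℝ) ^ (j + 1)) ^ 2 * x)))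
        * (4 * (3 + 12 * (d : ℝ)) ^ 3 / rho0 d L ^ 2 * ((L : ℝ) ^ (j + 1) * α₀) ^ 2)))
    (hcN : cN = 4 * (supC d L / ((L : ℝ) ^ (j + 1) * (1 - cruxC d L * (((L : ℝ) ^ (j + 1)) ^ 2 * x)))
        * (4 * (3 + 12 * (d : ℝ)) ^ 3 / rho0 d L ^ 2 * ((L : ℝ) ^ (j + 1) * α₀) ^ 2)))
    (hνm : ν = 24 * (Fintype.card (T4AveragingDeficitWall.Plane d) : ℝ) * (supC d L / ((L : ℝ) ^ (j + 1) * (1 - cruxC d L * (((L : ℝ) ^ (j + 1)) ^ 2 * x)))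
        * (4 * (3 + 12 * (d : ℝ)) ^ 3 / rho0 d L ^ 2 * ((L : ℝ) ^ (j + 1) * α₀) ^ 2)))
    -- THE ONE REMAINING SLICE-SOLVER LETTER IN SOURCE FORM (B9 Thm 3.3 TYPE): on the block-COMB slice, a skew periodic bond SOURCE `H` representing the Hessian functional on the
    -- W-tangent slice with `‖H‖_∞ ≤ g` forces `‖curl_W X‖ ≤ K·g + K_X·R`
    (hSrc : ∀ X : Site d → Fin d → Matrix n n ℂ, IsSkewDir X →
      (∀ (z : Site d) (μ : Fin d), (∀ κ, κ < μ → cmod (L ^ (j + 1)) z κ = 0) → cmod (L ^ (j + 1)) z μ + 1 < ((L ^ (j + 1) : ℕ) : ℤ) → X z μ = 0) →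
      IsPeriodicDir X ((N * L ^ (j + 1) : ℕ) : ℤ) → dirIter L (j + 1) W X = 0 → ∀ R : ℝ, (∀ y κ', ‖X y κ'‖ ≤ R) →
      ∀ H : Site d → Fin d → Matrix n n ℂ, IsSkewDir H → IsPeriodicDir H ((N * L ^ (j + 1) : ℕ) : ℤ) → ∀ g : ℝ, 0 ≤ g → (∀ (y : Site d) (κ : Fin d), ‖H y κ‖ ≤ g) →
      (∀ Y : Site d → Fin d → Matrix n n ℂ, IsSkewDir Y → IsPeriodicDir Y ((N * L ^ (j + 1) : ℕ) : ℤ) → dirIter L (j + 1) W Y = 0 →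
        hess W X Y (perWin d (N * L ^ (j + 1))) = srcPair H Y (periodBox (d := d) (N * L ^ (j + 1)))) →
      ∀ z μ' ν', μ' ≠ ν' → ‖curlAt W X z μ' ν'‖ ≤ K * g + KX * R)
    (hcritW : ∀ Y : Site d → Fin d → Matrix n n ℂ, IsSkewDir Y → IsPeriodicDir Y ((N * L ^ (j + 1) : ℕ) : ℤ) → dirIter L (j + 1) W Y = 0 →
      dAction W Y (perWin d (N * L ^ (j + 1))) = 0) :
    SmallField U (x + ((Fintype.card n * K) * (
        ((x + 4 * (Real.exp α₀ - 1))
            * ((curl1C d L / (1 - thetaLoc d L * (((L : ℝ) ^ (j + 1)) ^ 2 * (x + 4 * (Real.exp α₀ - 1)))))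
                * (((L : ℝ) ^ (j + 1)) ^ d / ((L : ℝ) ^ (j + 1)) ^ 2))
            * (Real.exp (((L : ℝ) ^ d / L) * ((d : ℝ) * (16 * ((d : ℝ) + 1) * ((d : ℝ) + 4) * (L : ℝ) ^ 2)
                  * (1250 * ((nbRad d L : ℝ) + L) + 8 * ((d : ℝ) * L) + 2 * L)) * (2 / twoLevelSmall d L))
                * ((L : ℝ) / (L : ℝ) ^ d) ^ j
                * (((d : ℝ) * (2 * nbRad d L + 1) ^ d) * ((2 * (d : ℝ) + 4) * (L : ℝ) ^ 2) * (2 * (L : ℝ) ^ j) * (Real.exp α₀ - 1)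
                  + (17 / 8 * ((L : ℝ) ^ 2) ^ j * (x + 4 * (Real.exp α₀ - 1)))
                    * (((d : ℝ) * (2 * nbRad d L + 1) ^ d) * ((2 * (d : ℝ) + 4)
                          * (2 * (2 * L * (nbRad d L : ℝ) + 128 * ((d : ℝ) + 1) * ((d : ℝ) + 4) * (L : ℝ) ^ 2)))
                      + ((d : ℝ) * (2 * nbRad d L + 1) ^ d) * ((2 * (d : ℝ) + 4) * (L : ℝ) ^ 2 * (2 * (nbRad d L : ℝ))
                          + 2 * (8 * (L : ℝ) + (1250 * ((nbRad d L : ℝ) + L) + 8 * (d * L) + 2 * L))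
                              * (16 * ((d : ℝ) + 1) * ((d : ℝ) + 4) * (L : ℝ) ^ 2))))))
        + (Fintype.card (T4AveragingDeficitWall.Plane d) : ℝ)
          * (2 * (240 * (Real.exp α₀ - 1) * α₀ * (2 * ((4 * ((d : ℝ) * αE / ((L ^ (j + 1) : ℕ) : ℝ) + ((L ^ (j + 1) : ℕ) : ℝ) * ((((d : ℝ) - 1) * (2 * gU) + ((d : ℝ) - 1) * (2 * gW) + d * (2 * (Real.exp αE - 1) * xU + 2 * (xU * x) + 2 * (x * (2 + x) * x) + 2 * (xU * (2 + xU) * xU))) + 2 * (b₀ + 3 * (cRE * b₀)))) + (4 * ((L ^ (j + 1) : ℕ) : ℝ) * (8 * d * (Real.exp (4 * αE) - 1) * x + 10 * d * x + 2 * (2 * (d : ℝ) ^ 2 * (((L ^ (j + 1) : ℕ) : ℝ) + 1) * (2 * gW) + 8 * (d : ℝ) ^ 3 * (((L ^ (j + 1) : ℕ) : ℝ) + 1) ^ 2 * x ^ 2) + 12 * d * (2 * (d : ℝ) * (((L ^ (j + 1) : ℕ) : ℝ) + 1) * x) ^ 2) + 4 * (2 * (d : ℝ) * (((L ^ (j +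 1) : ℕ) : ℝ) + 1) * x)) * αE + 2 * x * αE) + 2 * δ + 2 * (4 * (2 * θu + δ) * (αE + δ))) + 24 * α₀ * (Real.exp α₀ - 1) + x) + 8 * α₀ * (2 * ((4 * ((d : ℝ) * αE / ((L ^ (j + 1) : ℕ) : ℝ) + ((L ^ (j + 1) : ℕ) : ℝ) * ((((d : ℝ) - 1) * (2 * gU) + ((d : ℝ) - 1) * (2 * gW) + d * (2 * (Real.exp αE - 1) * xU + 2 * (xU * x) + 2 * (x * (2 + x) * x) + 2 * (xU * (2 + xU) * xU))) + 2 * (b₀ + 3 * (cRE * b₀)))) + (4 * ((L ^ (j + 1) : ℕ) : ℝ) * (8 * d * (Real.exp (4 * αE) - 1) * x + 10 * d * x + 2 * (2 * (d : ℝ) ^ 2 * (((L ^ (j + 1) : ℕ) : ℝ) + 1) * (2 * gW) + 8 * (d : ℝ) ^ 3 * (((L ^ (j + 1) : ℕ) : ℝ) + 1) ^ 2 * x ^ 2) + 12 * d * (2 * (d : ℝ) * (((L ^ (j + 1) : ℕ) : ℝ) + 1) * x) ^ 2) + 4 * (2 * (d : ℝ) * (((L ^ (j + 1) : ℕ) :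 ℝ) + 1) * x)) * αE + 2 * x * αE) + 2 * δ + 2 * (4 * (2 * θu + δ) * (αE + δ))) + 24 * α₀ * (Real.exp α₀ - 1))
              + 6 * (Real.exp α₀ - 1) * (2 * ((4 * ((d : ℝ) * αE / ((L ^ (j + 1) : ℕ) : ℝ) + ((L ^ (j + 1) : ℕ) : ℝ) * ((((d : ℝ) - 1) * (2 * gU) + ((d : ℝ) - 1) * (2 * gW) + d * (2 * (Real.exp αE - 1) * xU + 2 * (xU * x) + 2 * (x * (2 + x) * x) + 2 * (xU * (2 + xU) * xU))) + 2 * (b₀ + 3 * (cRE * b₀)))) + (4 * ((L ^ (j + 1) : ℕ) : ℝ) * (8 * d * (Real.exp (4 * αE) - 1) * x + 10 * d * x + 2 * (2 * (d : ℝ) ^ 2 * (((L ^ (j + 1) : ℕ) : ℝ) + 1) * (2 * gW) + 8 * (d : ℝ) ^ 3 * (((L ^ (j + 1) : ℕ) : ℝ) + 1) ^ 2 * x ^ 2) + 12 * d * (2 * (d : ℝ) * (((L ^ (j + 1) : ℕ) : ℝ) + 1) * x) ^ 2) + 4 * (2 * (d : ℝ) * (((L ^ (j + 1) : ℕ) :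 ℝ) + 1) * x)) * αE + 2 * x * αE) + 2 * δ + 2 * (4 * (2 * θu + δ) * (αE + δ))) + 24 * (Real.exp α₀ - 1) * α₀)
              + (2 * ((4 * ((d : ℝ) * αE / ((L ^ (j + 1) : ℕ) : ℝ) + ((L ^ (j + 1) : ℕ) : ℝ) * ((((d : ℝ) - 1) * (2 * gU) + ((d : ℝ) - 1) * (2 * gW) + d * (2 * (Real.exp αE - 1) * xU + 2 * (xU * x) + 2 * (x * (2 + x) * x) + 2 * (xU * (2 + xU) * xU))) + 2 * (b₀ + 3 * (cRE * b₀)))) + (4 * ((L ^ (j + 1) : ℕ) : ℝ) * (8 * d * (Real.exp (4 * αE) - 1) * x + 10 * d * x + 2 * (2 * (d : ℝ) ^ 2 * (((L ^ (j + 1) : ℕ) : ℝ) + 1) * (2 * gW) + 8 * (d : ℝ) ^ 3 * (((L ^ (j + 1) : ℕ) : ℝ) + 1) ^ 2 * x ^ 2) + 12 * d * (2 * (d : ℝ) * (((L ^ (j + 1) : ℕ) : ℝ) + 1) * x) ^ 2) + 4 * (2 * (d : ℝ) * (((L ^ (j + 1) : ℕ) : ℝ) + 1) * x)) * αE + 2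 * x * αE) + 2 * δ + 2 * (4 * (2 * θu + δ) * (αE + δ))) + 24 * (Real.exp α₀ - 1) * α₀) * (2 * ((4 * ((d : ℝ) * αE / ((L ^ (j + 1) : ℕ) : ℝ) + ((L ^ (j + 1) : ℕ) : ℝ) * ((((d : ℝ) - 1) * (2 * gU) + ((d : ℝ) - 1) * (2 * gW) + d * (2 * (Real.exp αE - 1) * xU + 2 * (xU * x) + 2 * (x * (2 + x) * x) + 2 * (xU * (2 + xU) * xU))) + 2 * (b₀ + 3 * (cRE * b₀)))) + (4 * ((L ^ (j + 1) : ℕ) : ℝ) * (8 * d * (Real.exp (4 * αE) - 1) * x + 10 * d * x + 2 * (2 * (d : ℝ) ^ 2 * (((L ^ (j + 1) : ℕ) : ℝ) + 1) * (2 * gW) + 8 * (d : ℝ) ^ 3 * (((L ^ (j + 1) : ℕ) : ℝ) + 1) ^ 2 * x ^ 2) + 12 * d * (2 * (d : ℝ) * (((L ^ (j + 1) : ℕ) : ℝ) + 1) * x) ^ 2) + 4 * (2 * (d : ℝ) * (((L ^ (j + 1) : ℕ) : ℝ) + 1) * x)) * αE + 2 * x * αE) + 2 * δ + 2 * (4 *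 (2 * θu + δ) * (αE + δ))) + 24 * α₀ * (Real.exp α₀ - 1))
              + 960 * (Real.exp α₀ - 1) * α₀ ^ 2 + 32 * x * α₀ ^ 2)
            + (64 * α₀ * ((4 * ((d : ℝ) * αE / ((L ^ (j + 1) : ℕ) : ℝ) + ((L ^ (j + 1) : ℕ) : ℝ) * ((((d : ℝ) - 1) * (2 * gU) + ((d : ℝ) - 1) * (2 * gW) + d * (2 * (Real.exp αE - 1) * xU + 2 * (xU * x) + 2 * (x * (2 + x) * x) + 2 * (xU * (2 + xU) * xU))) + 2 * (b₀ + 3 * (cRE * b₀)))) + (4 * ((L ^ (j + 1) : ℕ) : ℝ) * (8 * d * (Real.exp (4 * αE) - 1) * x + 10 * d * x + 2 * (2 * (d : ℝ) ^ 2 * (((L ^ (j + 1) : ℕ) : ℝ) + 1) * (2 * gW) + 8 * (d : ℝ) ^ 3 * (((L ^ (j + 1) : ℕ) : ℝ) + 1) ^ 2 * x ^ 2) + 12 * d * (2 * (d : ℝ) * (((L ^ (j + 1) : ℕ) : ℝ) + 1) * x) ^ 2) + 4 * (2 * (d : ℝ) * (((L ^ (j + 1) : ℕ) : ℝ) + 1)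 * x)) * αE + 2 * x * αE) + 2 * δ + 2 * (4 * (2 * θu + δ) * (αE + δ))) + 1024 * x * α₀ ^ 2))
        + ν) + ((1 + 2 * ((d : ℝ) * ((L : ℝ) ^ (j + 1) - 1))) * KX
            + 2 * (x + (Fintype.card n * K) * ((d : ℝ) * gW + 12 * (Fintype.card (T4AveragingDeficitWall.Plane d) : ℝ) * x ^ 2))
              * ((d : ℝ) * ((L : ℝ) ^ (j + 1) - 1))) * (α₀ + aN) + cN + 28 * α₀ ^ 2)) := by
  have hL1 : 1 ≤ L := by omega
  exact smallField_of_tanCritical_roadB_comb hd hL j hWu hWP hx hs hWx hα0 hs' hθ hθl hε hUu hUP hxU hsU hUxU hcritU hTopUW hgW hgU hbx hcx hbx' hcx'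
    hr₀ hb₀ hcRE hreg₁ hreg₂ hreg₃ hline hαE hθu hαE40 hθu160 hδ hδ40 hα₀ hs1 hA hσ0 haN hcN hνm
    (combSliceSolver_of_sourceSolver hL1 j hWu hx hs hWx hSrc) hcritW

end

end Summit.QuantumFields.BalabanUV.T4Continuum.NE7CombSliceSourceDuality
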